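import Literature.NumberTheory.DiophantineGeometry.MultiplicativeGroupApproximation
import Mathlib.NumberTheory.Padics.PadicVal.Basic
import Mathlib.Analysis.Seminorm
import Mathlib.Data.Nat.Factorization.Basic
import Mathlib.NumberTheory.PrimeCounting
import HarnessLib

/-!
# Evertse–Győry Theorem 4.2.1 over `ℚ`: the elementary ingredients of the printed proof

Topic `NumberTheory/DiophantineGeometry`; namespace
`Literature.NumberTheory.DiophantineGeometry.Dioph`.
Companion of `MultiplicativeGroupApproximation.lean`, which vendors Evertse–Győry,
*Unit Equations in Diophantine Number Theory* (2015), Theorem 4.2.1 for `K = ℚ` as the named fact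
`evertseGyory_thm_4_2_1_rat`.

The printed proof of Theorem 4.2.1 (book §4.4.2, pp. 80–81) rests on two deep inputs — Theorem
3.2.8 (p. 62: the uniform lower bound for linear forms in logarithms, from Matveev 2000 at the
infinite place and Yu 2007 at the finite places) and Proposition 4.3.4 (p. 71: geometry of
numbers, from Minkowski's second theorem, Mahler's basis theorem and the
Borosh–Flahive–Rubin–Treybig lemma) — and is otherwise elementary. This file PROVES the
elementary ingredients for `K = ℚ` (no named facts are introduced):

* Proposition 3.2.9 for `d = 1` (`log_two_le_logHeight₁`: `h(x) ≥ log 2` for `x ∈ ℚ* ∖ {±1}`);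
* the Liouville-type inequalities `log |1 − y|_v ≥ −log 2 − h(y)` at the infinite place and at
  every prime (`liouville_infinite`, `liouville_finite`) — the product-formula step on p. 81;
* the lattice model of a finitely generated subgroup of `ℚ*` used in the proof of Proposition
  4.4.1 (p. 81): `y ↦ (ord_p y)_{p ∈ P}` (`padicOrdVec`) maps the `P`-units (`IsPUnit`) to
  `ℤ^P ⊂ ℝ^P`,
  the logarithmic height becomes the norm `N(z) = ½ (|∑_p z_p log p| + ∑_p |z_p| log p)`
  (`heightSeminorm`; the identity (4.4.18) is `logHeight₁_eq_heightSeminorm_padicOrdVec`), non-zero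
  lattice vectors have `N ≥ log 2` (`log_two_le_heightSeminorm_padicOrdVec`), the kernel is `{±1}`
  (`eq_sign_of_padicOrdVec_eq_zero`), and a system of generators minimising `∏ N(aᵢ)` exists
  (`exists_min_system`, to be fed with Northcott finiteness);
* the bookkeeping of constants in Cases A and B of the proof for `d = 1`: `C₆(n, 1)` of Theorem
  3.2.8 (`egC6`), `c₈(m) = 2(m+1) log*(m) C₆(m+1, 1)` (`egC8_eq_mul_egC6`),
  `log*(c₁₇' X) ≤ 2(m+1) log*(m) log*(X)` with `c₁₇' = m^{2m}/log 2` (`logStar_c17_mul_le`),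
  `N(v)/log N(v) ≥ e` (`exp_one_le_div_log`), and the two final comparisons
  (`eg421_caseA_bound`, `eg421_caseB_bound`).

## A correction for `d = 1`

The printed proof of Proposition 4.4.1 takes `θ = 2 / (d (log 3d)³)` "by Proposition 3.2.9"; for
`d = 1` Proposition 3.2.9 only gives `θ = log 2 < 2/(log 3)³ ≈ 1.51`, and (4.4.16) as printed is
false for `d = 1` (e.g. `Γ = ⟨2⟩`, `ξ = 2^b`: it would give `|b| ≤ 0.66 · |b| · log 2`). Theorem
4.2.1 itself is unaffected: with the corrected constant `c₁₇' = m^{2m} / log 2` in place of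
`c₁₇ = m^{2m} (1/2)(log 3)³`, Case A needs `log*(c₁₇' X) ≤ 2(m+1) log*(m) log*(X)`, which holds
because `−log log 2 ≤ 1 ≤ log* m` (`logStar_c17_mul_le`), and Case B has slack by a factor
`> 10¹⁰` (`eg421_caseB_bound`). The constants lemmas below use the corrected `c₁₇'`.

## References

* [EvertseGyory2015] J.-H. Evertse, K. Győry, *Unit Equations in Diophantine Number Theory*,
  Cambridge Stud. Adv. Math. 146, CUP 2015, doi:10.1017/CBO9781316160749 — Thm 3.2.8 and
  Prop 3.2.9 (p. 62), Thm 4.2.1 (p. 68), Prop 4.3.4 (p. 71), Prop 4.4.1 and the proof of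
  Thm 4.2.1 (pp. 80–81).
-/

open Height Real Finset Module

noncomputable section

namespace Literature.NumberTheory.DiophantineGeometry.Dioph

/-- The constant `C₆(n, d) = λ · (16 e d)^{3n+2} · (log* d)²` of Evertse–Győry's Theorem 3.2.8,
for `d = 1` (so `(log* d)² = 1`), with `λ = 12` if `n = 2` and `λ = 1` if `n ≥ 3`.
[cite: EvertseGyory2015, Thm 3.2.8 (p. 62)] -/
def egC6 (n : ℕ) : ℝ :=
  (if n = 2 then 12 else 1) * (16 * Real.exp 1) ^ (3 * n + 2)

/-- Unfolding lemma for `egC6`. [folklore] -/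
theorem egC6_def (n : ℕ) :
    egC6 n = (if n = 2 then 12 else 1) * (16 * Real.exp 1) ^ (3 * n + 2) :=
  rfl

/-! ### Proposition 3.2.9 over `ℚ` -/

/-- **Evertse–Győry, Proposition 3.2.9, for `d = 1`** (Voutier 1996; elementary over `ℚ`): a
non-zero rational number which is not a root of unity (`x ≠ ±1`) has `h(x) ≥ log 2`.
[cite: EvertseGyory2015, Prop 3.2.9 (p. 62)] -/
theorem log_two_le_logHeight₁ {x : ℚ} (h0 : x ≠ 0) (h1 : x ≠ 1) (h2 : x ≠ -1) :
    Real.log 2 ≤ logHeight₁ x := by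
  rw [Rat.logHeight₁_eq_log_max]
  apply Real.log_le_log two_pos
  have : 2 ≤ max x.num.natAbs x.den := by
    by_contra hlt
    push Not at hlt
    have hden : x.den = 1 := by
      have h1 := x.den_pos
      have h2 : x.den < 2 := lt_of_le_of_lt (le_max_right _ _) hlt
      omega
    have hnum : x.num.natAbs < 2 := lt_of_le_of_lt (le_max_left _ _) hlt
    have hx : x = x.num := by
      rw [← Rat.num_div_den x, hden]; simp
    have : x.num = 0 ∨ x.num = 1 ∨ x.num = -1 := by omega
    rcases this with h | h | h
    · exact h0 (by rw [hx, h]; simp)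
    · exact h1 (by rw [hx, h]; simp)
    · exact h2 (by rw [hx, h]; simp)
  exact_mod_cast this

/-! ### Liouville-type inequalities over `ℚ` (the product-formula step, p. 81) -/

/-- `log |z| ≥ −h(z)` for `z ∈ ℚ*` (`|a/b| ≥ 1/b ≥ 1/H(a/b)`). [folklore] -/
theorem neg_logHeight₁_le_log_abs {z : ℚ} (hz : z ≠ 0) :
    -logHeight₁ z ≤ Real.log |((z : ℚ) : ℝ)| := by
  rw [Rat.logHeight₁_eq_log_max]
  have hden : (0 : ℝ) < z.den := by exact_mod_cast z.den_pos
  have hnum : (1 : ℝ) ≤ |(z.num : ℝ)| := by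
    rw [← Int.cast_abs]; exact_mod_cast Int.one_le_abs (Rat.num_ne_zero.mpr hz)
  have hcast : ((z : ℚ) : ℝ) = (z.num : ℝ) / (z.den : ℝ) := Rat.cast_def z
  rw [hcast, abs_div, abs_of_pos hden, Real.log_div (by positivity) hden.ne']
  have h1 : 0 ≤ Real.log |(z.num : ℝ)| := Real.log_nonneg hnum
  have h2 : Real.log z.den ≤ Real.log ((max z.num.natAbs z.den : ℕ) : ℝ) := by
    apply Real.log_le_log hden; exact_mod_cast le_max_right _ _
  linarith

/-- `ord_p(z) · log p ≤ h(z)` for `z ∈ ℚ*`, i.e. `log |z|_p ≥ −h(z)` (`p^{ord_p a} ≤ |a| ≤ H(a/b)`).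
[folklore] -/
theorem padicValRat_mul_log_le_logHeight₁ (p : ℕ) (hp : p.Prime) {z : ℚ} (hz : z ≠ 0) :
    (padicValRat p z : ℝ) * Real.log p ≤ logHeight₁ z := by
  have hp1 : (1 : ℝ) < p := by exact_mod_cast hp.one_lt
  rw [Rat.logHeight₁_eq_log_max]
  have hnum0 : z.num.natAbs ≠ 0 := Int.natAbs_ne_zero.mpr (Rat.num_ne_zero.mpr hz)
  have hpow : p ^ padicValNat p z.num.natAbs ≤ z.num.natAbs :=
    Nat.le_of_dvd (Nat.pos_of_ne_zero hnum0) pow_padicValNat_dvd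
  have hlog : (padicValNat p z.num.natAbs : ℝ) * Real.log p ≤
      Real.log ((max z.num.natAbs z.den : ℕ) : ℝ) := by
    rw [← Real.log_pow]
    apply Real.log_le_log (by positivity)
    calc ((p : ℝ) ^ padicValNat p z.num.natAbs) = ((p ^ padicValNat p z.num.natAbs : ℕ) : ℝ) := by
          push_cast; ring
      _ ≤ (z.num.natAbs : ℝ) := by exact_mod_cast hpow
      _ ≤ _ := by exact_mod_cast le_max_left _ _
  have hlogp : 0 ≤ Real.log p := Real.log_nonneg hp1.le
  have hle' : (padicValRat p z : ℝ) ≤ (padicValNat p z.num.natAbs : ℝ) := by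
    have h : padicValRat p z = (padicValNat p z.num.natAbs : ℤ) - (padicValNat p z.den : ℤ) := rfl
    rw [h, Int.cast_sub, Int.cast_natCast, Int.cast_natCast]
    linarith [(Nat.cast_nonneg (padicValNat p z.den) : (0:ℝ) ≤ _)]
  calc (padicValRat p z : ℝ) * Real.log p ≤ (padicValNat p z.num.natAbs : ℝ) * Real.log p :=
        mul_le_mul_of_nonneg_right hle' hlogp
    _ ≤ _ := hlog

/-- `h(1 − y) ≤ log 2 + h(y)` over `ℚ` (Mathlib's `logHeight₁_sub_le` with `totalWeight ℚ = 1`).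
[folklore] -/
theorem logHeight₁_one_sub_le (y : ℚ) : logHeight₁ (1 - y) ≤ Real.log 2 + logHeight₁ y := by
  have := logHeight₁_sub_le (1 : ℚ) y
  rw [NumberField.totalWeight_eq_finrank, Module.finrank_self, logHeight₁_one] at this
  simpa using this

/-- Liouville inequality at the infinite place of `ℚ`: `log |1 − y| ≥ −(log 2 + h(y))` for `y ≠ 1`
(the case `K = ℚ`, `v = ∞` of the display on p. 81). [cite: EvertseGyory2015, §4.4.2 (p. 81)] -/
theorem liouville_infinite {y : ℚ} (hy : y ≠ 1) :
    -(Real.log 2 + logHeight₁ y) ≤ Real.log |(((1 - y : ℚ)) : ℝ)| := by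
  have hz : (1 - y : ℚ) ≠ 0 := sub_ne_zero.mpr (Ne.symm hy)
  have h1 := neg_logHeight₁_le_log_abs hz
  have h2 := logHeight₁_one_sub_le y
  linarith

/-- Liouville inequality at a finite place of `ℚ`: `log |1 − y|_p = −ord_p(1 − y) log p ≥
−(log 2 + h(y))` for `y ≠ 1` (the case `K = ℚ`, `v = p` of the display on p. 81).
[cite: EvertseGyory2015, §4.4.2 (p. 81)] -/
theorem liouville_finite {y : ℚ} (hy : y ≠ 1) (p : ℕ) (hp : p.Prime) :
    -(Real.log 2 + logHeight₁ y) ≤ -(padicValRat p (1 - y) : ℝ) * Real.log p := by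
  have hz : (1 - y : ℚ) ≠ 0 := sub_ne_zero.mpr (Ne.symm hy)
  have h1 := padicValRat_mul_log_le_logHeight₁ p hp hz
  have h2 := logHeight₁_one_sub_le y
  linarith

/-! ### The height norm on `ℝ^P` (proof of Proposition 4.4.1, p. 81, for `K = ℚ`) -/

section HeightNorm

variable (P : Finset ℕ)

/-- The valuation vector `(ord_p y)_{p ∈ P} ∈ ℝ^P` of `y ∈ ℚ` (the coordinates `x` of (4.4.17)
for `K = ℚ`, where `Γ/Γ_tors` embeds into `⊕_p ℤ`). [cite: EvertseGyory2015, §4.4.2 (p. 81)] -/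
def padicOrdVec (y : ℚ) : P → ℝ := fun p => (padicValRat p y : ℝ)

/-- The height norm `N(z) = ½ (|∑_p z_p log p| + ∑_p |z_p| log p)` on `ℝ^P`: the norm `‖x‖` of
the proof of Proposition 4.4.1 for `K = ℚ`, `S = {∞} ∪ P` (`log |y|_∞ = ∑_p ord_p(y) log p` for a
`P`-unit `y`). [cite: EvertseGyory2015, §4.4.2 (p. 81)] -/
def heightNormFun (z : P → ℝ) : ℝ :=
  (|∑ p, z p * Real.log p| + ∑ p, |z p| * Real.log p) / 2

/-- Triangle inequality for the height norm. [folklore] -/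
theorem heightNormFun_add_le (z w : P → ℝ) :
    heightNormFun P (z + w) ≤ heightNormFun P z + heightNormFun P w := by
  unfold heightNormFun
  have h1 : |∑ p, (z + w) p * Real.log p| ≤ |∑ p, z p * Real.log p| + |∑ p, w p * Real.log p| := by
    have : ∑ p, (z + w) p * Real.log p = ∑ p, z p * Real.log p + ∑ p, w p * Real.log p := by
      rw [← Finset.sum_add_distrib]; apply Finset.sum_congr rfl; intro p _; simp [add_mul]
    rw [this]; exact abs_add_le _ _
  have h2 : ∑ p, |(z + w) p| * Real.log p ≤ ∑ p, |z p| * Real.log p + ∑ p, |w p| * Real.log p := by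
    rw [← Finset.sum_add_distrib]
    apply Finset.sum_le_sum; intro p _
    have hlog : 0 ≤ Real.log p := Real.log_natCast_nonneg _
    have := abs_add_le (z p) (w p)
    simp only [Pi.add_apply]
    nlinarith
  linarith

/-- Homogeneity of the height norm. [folklore] -/
theorem heightNormFun_smul (c : ℝ) (z : P → ℝ) :
    heightNormFun P (c • z) = ‖c‖ * heightNormFun P z := by
  unfold heightNormFun
  have h1 : ∑ p, (c • z) p * Real.log p = c * ∑ p, z p * Real.log p := by
    rw [Finset.mul_sum]; apply Finset.sum_congr rfl; intro p _; simp [mul_assoc]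
  have h2 : ∑ p, |(c • z) p| * Real.log p = |c| * ∑ p, |z p| * Real.log p := by
    rw [Finset.mul_sum]; apply Finset.sum_congr rfl; intro p _; simp [abs_mul, mul_assoc]
  rw [h1, h2, abs_mul, Real.norm_eq_abs]; ring

/-- The height norm as a `Seminorm ℝ (P → ℝ)` (it is a norm when `P` consists of primes,
`heightSeminorm_eq_zero`). [cite: EvertseGyory2015, §4.4.2 (p. 81)] -/
def heightSeminorm : Seminorm ℝ (P → ℝ) :=
  Seminorm.of (heightNormFun P) (heightNormFun_add_le P) (heightNormFun_smul P)

/-- Unfolding lemma for `heightSeminorm`. [folklore] -/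
theorem heightSeminorm_apply (z : P → ℝ) :
    heightSeminorm P z = (|∑ p, z p * Real.log p| + ∑ p, |z p| * Real.log p) / 2 :=
  rfl

variable {P}

/-- The height seminorm is definite when `P` consists of primes (`log p > 0`). [folklore] -/
theorem heightSeminorm_eq_zero (hP : ∀ p ∈ P, p.Prime) {z : P → ℝ}
    (hz : heightSeminorm P z = 0) :
    z = 0 := by
  rw [heightSeminorm_apply] at hz
  have hnn : ∀ p : P, 0 ≤ |z p| * Real.log p := fun p =>
    mul_nonneg (abs_nonneg _) (Real.log_natCast_nonneg _)
  have hsum : ∑ p, |z p| * Real.log p = 0 := by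
    have h0 : 0 ≤ ∑ p, |z p| * Real.log p := Finset.sum_nonneg fun p _ => hnn p
    have := abs_nonneg (∑ p, z p * Real.log p)
    linarith
  rw [Finset.sum_eq_zero_iff_of_nonneg fun p _ => hnn p] at hsum
  funext p
  have hp : 0 < Real.log p := Real.log_pos (by exact_mod_cast (hP p p.2).one_lt)
  have := hsum p (Finset.mem_univ _)
  rcases mul_eq_zero.mp this with h | h
  · simpa using h
  · exact absurd h hp.ne'

/-! ### `P`-units -/

/-- `y ∈ ℚ` is a `P`-unit: `y ≠ 0` and `ord_p y = 0` for every prime `p ∉ P` (for `P` a finite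
set of primes these form the group `O_S^*`, `S = {∞} ∪ P`). [folklore] -/
def IsPUnit (P : Finset ℕ) (y : ℚ) : Prop :=
  y ≠ 0 ∧ ∀ p : ℕ, p.Prime → p ∉ P → padicValRat p y = 0

/-- A `P`-unit is non-zero. [folklore] -/
theorem IsPUnit.ne_zero {y : ℚ} (h : IsPUnit P y) : y ≠ 0 := h.1

/-- `1` is a `P`-unit. [folklore] -/
theorem isPUnit_one : IsPUnit P 1 := ⟨one_ne_zero, fun p _ _ => by simp⟩

/-- `P`-units are closed under multiplication. [folklore] -/
theorem IsPUnit.mul {y y' : ℚ} (h : IsPUnit P y) (h' : IsPUnit P y') : IsPUnit P (y * y') := by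
  refine ⟨mul_ne_zero h.1 h'.1, fun p hp hpP => ?_⟩
  haveI := Fact.mk hp
  rw [padicValRat.mul h.1 h'.1, h.2 p hp hpP, h'.2 p hp hpP, add_zero]

/-- `P`-units are closed under inversion. [folklore] -/
theorem IsPUnit.inv {y : ℚ} (h : IsPUnit P y) : IsPUnit P y⁻¹ := by
  refine ⟨inv_ne_zero h.1, fun p hp hpP => ?_⟩
  haveI := Fact.mk hp
  rw [padicValRat.inv, h.2 p hp hpP, neg_zero]

/-- `P`-units are closed under negation. [folklore] -/
theorem IsPUnit.neg {y : ℚ} (h : IsPUnit P y) : IsPUnit P (-y) := by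
  refine ⟨neg_ne_zero.mpr h.1, fun p hp hpP => ?_⟩
  haveI := Fact.mk hp
  rw [padicValRat.neg, h.2 p hp hpP]

/-- `P`-units are closed under integer powers. [folklore] -/
theorem IsPUnit.zpow {y : ℚ} (h : IsPUnit P y) (k : ℤ) : IsPUnit P (y ^ k) := by
  refine ⟨zpow_ne_zero k h.1, fun p hp hpP => ?_⟩
  haveI := Fact.mk hp
  rw [padicValRat.zpow, h.2 p hp hpP, mul_zero]

/-- `P`-units are closed under finite products. [folklore] -/
theorem IsPUnit.prod {ι : Type*} (s : Finset ι) {f : ι → ℚ} (h : ∀ i ∈ s, IsPUnit P (f i)) :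
    IsPUnit P (∏ i ∈ s, f i) := by
  classical
  induction s using Finset.induction_on with
  | empty => simpa using isPUnit_one
  | insert a s ha ih =>
    rw [Finset.prod_insert ha]
    exact (h a (Finset.mem_insert_self a s)).mul (ih fun i hi => h i (Finset.mem_insert_of_mem hi))

/-- `±1` are `P`-units. [folklore] -/
theorem isPUnit_of_sign {ζ : ℚ} (hζ : ζ = 1 ∨ ζ = -1) : IsPUnit P ζ := by
  rcases hζ with rfl | rfl
  · exact isPUnit_one
  · exact isPUnit_one.neg

/-! ### `padicOrdVec` is a homomorphism on `ℚ*` -/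

/-- `ord(y y') = ord(y) + ord(y')`. [folklore] -/
theorem padicOrdVec_mul (hP : ∀ p ∈ P, p.Prime) {y y' : ℚ} (hy : y ≠ 0) (hy' : y' ≠ 0) :
    padicOrdVec P (y * y') = padicOrdVec P y + padicOrdVec P y' := by
  funext p
  haveI := Fact.mk (hP p p.2)
  simp [padicOrdVec, padicValRat.mul hy hy']

/-- `ord(y^k) = k · ord(y)`. [folklore] -/
theorem padicOrdVec_zpow (hP : ∀ p ∈ P, p.Prime) (y : ℚ) (k : ℤ) :
    padicOrdVec P (y ^ k) = k • padicOrdVec P y := by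
  funext p
  haveI := Fact.mk (hP p p.2)
  simp [padicOrdVec, padicValRat.zpow]

/-- `ord(y⁻¹) = −ord(y)`. [folklore] -/
theorem padicOrdVec_inv (hP : ∀ p ∈ P, p.Prime) (y : ℚ) : padicOrdVec P y⁻¹ = -padicOrdVec P y := by
  funext p
  haveI := Fact.mk (hP p p.2)
  simp [padicOrdVec, padicValRat.inv]

/-- `ord(−y) = ord(y)`. [folklore] -/
theorem padicOrdVec_neg (y : ℚ) : padicOrdVec P (-y) = padicOrdVec P y := by
  funext p
  simp [padicOrdVec, padicValRat.neg]

/-- `ord(1) = 0`. [folklore] -/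
theorem padicOrdVec_one : padicOrdVec P 1 = 0 := by
  funext p; simp [padicOrdVec]

/-- `ord(±1) = 0`. [folklore] -/
theorem padicOrdVec_sign {ζ : ℚ} (hζ : ζ = 1 ∨ ζ = -1) : padicOrdVec P ζ = 0 := by
  rcases hζ with rfl | rfl
  · exact padicOrdVec_one
  · rw [padicOrdVec_neg, padicOrdVec_one]

/-- `ord(∏ fᵢ^{kᵢ}) = ∑ kᵢ · ord(fᵢ)`. [folklore] -/
theorem padicOrdVec_prod_zpow {ι : Type*} [Fintype ι] (hP : ∀ p ∈ P, p.Prime) {f : ι → ℚ}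
    (hf : ∀ i, f i ≠ 0) (k : ι → ℤ) :
    padicOrdVec P (∏ i, f i ^ k i) = ∑ i, k i • padicOrdVec P (f i) := by
  classical
  induction (Finset.univ : Finset ι) using Finset.induction_on with
  | empty => simp [padicOrdVec_one]
  | insert a s ha ih =>
    rw [Finset.prod_insert ha, Finset.sum_insert ha, padicOrdVec_mul hP (zpow_ne_zero _ (hf a)), ih,
      padicOrdVec_zpow hP]
    exact Finset.prod_ne_zero_iff.mpr fun i _ => zpow_ne_zero _ (hf i)

/-! ### The height of a `P`-unit is the height norm of its valuation vector -/

/-- For a `P`-unit, the prime factors of the numerator lie in `P`. [folklore] -/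
theorem IsPUnit.primeFactors_num_subset {y : ℚ} (h : IsPUnit P y) :
    y.num.natAbs.primeFactors ⊆ P := by
  intro q hq
  rw [Nat.mem_primeFactors] at hq
  obtain ⟨hqp, hqdvd, -⟩ := hq
  by_contra hqP
  have h0 := h.2 q hqp hqP
  haveI := Fact.mk hqp
  have hnum : 1 ≤ padicValNat q y.num.natAbs :=
    one_le_padicValNat_of_dvd (Int.natAbs_ne_zero.mpr (Rat.num_ne_zero.mpr h.1)) hqdvd
  have hden : padicValNat q y.den = 0 := by
    apply padicValNat.eq_zero_of_not_dvd
    intro hd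
    have := Nat.Coprime.eq_one_of_dvd (Nat.Coprime.coprime_dvd_left hqdvd y.reduced) hd
    exact hqp.one_lt.ne' this
  have : padicValRat q y = (padicValNat q y.num.natAbs : ℤ) - (padicValNat q y.den : ℤ) := rfl
  rw [this, hden] at h0
  omega

/-- For a `P`-unit, the prime factors of the denominator lie in `P`. [folklore] -/
theorem IsPUnit.primeFactors_den_subset {y : ℚ} (h : IsPUnit P y) :
    y.den.primeFactors ⊆ P := by
  intro q hq
  rw [Nat.mem_primeFactors] at hq
  obtain ⟨hqp, hqdvd, -⟩ := hq
  by_contra hqP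
  have h0 := h.2 q hqp hqP
  haveI := Fact.mk hqp
  have hden : 1 ≤ padicValNat q y.den := one_le_padicValNat_of_dvd y.den_nz hqdvd
  have hnum : padicValNat q y.num.natAbs = 0 := by
    apply padicValNat.eq_zero_of_not_dvd
    intro hd
    have := Nat.Coprime.eq_one_of_dvd (Nat.Coprime.coprime_dvd_left hd y.reduced) hqdvd
    exact hqp.one_lt.ne' this
  have : padicValRat q y = (padicValNat q y.num.natAbs : ℤ) - (padicValNat q y.den : ℤ) := rfl
  rw [this, hnum] at h0
  omega

/-- `log n = ∑_{p ∈ P} v_p(n) log p` when the prime factors of `n ≠ 0` lie in `P` (unique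
factorisation). [folklore] -/
theorem log_eq_sum_padicValNat_mul_log (hP : ∀ p ∈ P, p.Prime) {n : ℕ} (hn : n ≠ 0)
    (hsub : n.primeFactors ⊆ P) :
    Real.log n = ∑ p : P, (padicValNat p n : ℝ) * Real.log p := by
  have hprod : (n : ℝ) = ∏ p ∈ P, (p : ℝ) ^ padicValNat p n := by
    have h1 : n.factorization.prod (fun p k => p ^ k) = n := Nat.prod_factorization_pow_eq_self hn
    have h2 : n.factorization.prod (fun p k => p ^ k) = ∏ p ∈ P, p ^ n.factorization p := by
      apply Finsupp.prod_of_support_subset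
      · rwa [Nat.support_factorization]
      · intro i _; simp
    have h3 : ∏ p ∈ P, p ^ n.factorization p = ∏ p ∈ P, p ^ padicValNat p n := by
      apply Finset.prod_congr rfl
      intro p hp
      rw [Nat.factorization_def n (hP p hp)]
    conv_lhs => rw [← h1, h2, h3]
    push_cast
    rfl
  rw [hprod, Real.log_prod]
  · rw [← Finset.sum_coe_sort]
    apply Finset.sum_congr rfl
    intro p _
    rw [Real.log_pow]
  · intro p hp
    have : (0 : ℝ) < p := by exact_mod_cast (hP p hp).pos
    positivity

/-- **(4.4.18) for `K = ℚ`.** For a `P`-unit `y`, `h(y) = N((ord_p y)_p)`: writing `y = ±n/d` in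
lowest terms, `log n` and `log d` are `∑_p v_p log p` over disjointly supported valuations, and
`½ (|log n − log d| + log n + log d) = log max(n, d) = h(y)`.
[cite: EvertseGyory2015, (4.4.18) (p. 81)] -/
theorem logHeight₁_eq_heightSeminorm_padicOrdVec (hP : ∀ p ∈ P, p.Prime) {y : ℚ} (h : IsPUnit P y) :
    logHeight₁ y = heightSeminorm P (padicOrdVec P y) := by
  set n := y.num.natAbs with hn
  set d := y.den with hd
  have hn0 : n ≠ 0 := Int.natAbs_ne_zero.mpr (Rat.num_ne_zero.mpr h.1)
  have hd0 : d ≠ 0 := y.den_nz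
  have hA := log_eq_sum_padicValNat_mul_log hP hn0 h.primeFactors_num_subset
  have hD := log_eq_sum_padicValNat_mul_log hP hd0 h.primeFactors_den_subset
  -- coordinates
  have hcoord : ∀ p : P, padicOrdVec P y p = (padicValNat p n : ℝ) - (padicValNat p d : ℝ) := by
    intro p
    have : padicValRat p y = (padicValNat p y.num.natAbs : ℤ) - (padicValNat p y.den : ℤ) := rfl
    simp only [padicOrdVec, this, Int.cast_sub, Int.cast_natCast, hn, hd]
  have hdisj : ∀ p : P, (padicValNat p n : ℝ) = 0 ∨ (padicValNat p d : ℝ) = 0 := by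
    intro p
    haveI := Fact.mk (hP p p.2)
    by_cases hpn : (p : ℕ) ∣ n
    · right
      have : ¬ (p : ℕ) ∣ d := by
        intro hpd
        have := Nat.Coprime.eq_one_of_dvd (Nat.Coprime.coprime_dvd_left hpn y.reduced) hpd
        exact (hP p p.2).one_lt.ne' this
      exact_mod_cast padicValNat.eq_zero_of_not_dvd this
    · left
      exact_mod_cast padicValNat.eq_zero_of_not_dvd hpn
  have hsum1 : ∑ p : P, padicOrdVec P y p * Real.log p = Real.log n - Real.log d := by
    rw [hA, hD, ← Finset.sum_sub_distrib]
    apply Finset.sum_congr rfl; intro p _; rw [hcoord]; ring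
  have hsum2 : ∑ p : P, |padicOrdVec P y p| * Real.log p = Real.log n + Real.log d := by
    rw [hA, hD, ← Finset.sum_add_distrib]
    apply Finset.sum_congr rfl; intro p _
    rw [hcoord]
    have h1 : (0 : ℝ) ≤ padicValNat p n := Nat.cast_nonneg _
    have h2 : (0 : ℝ) ≤ padicValNat p d := Nat.cast_nonneg _
    rcases hdisj p with h0 | h0
    · rw [h0, zero_sub, abs_neg, abs_of_nonneg h2]; ring
    · rw [h0, sub_zero, abs_of_nonneg h1]; ring
  rw [heightSeminorm_apply, hsum1, hsum2, Rat.logHeight₁_eq_log_max]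
  have hnpos : (0 : ℝ) < n := by exact_mod_cast Nat.pos_of_ne_zero hn0
  have hdpos : (0 : ℝ) < d := by exact_mod_cast Nat.pos_of_ne_zero hd0
  rcases le_total n d with hle | hle
  · have : max n d = d := max_eq_right hle
    rw [this]
    have hlog : Real.log n ≤ Real.log d := Real.log_le_log hnpos (by exact_mod_cast hle)
    rw [abs_of_nonpos (by linarith)]
    ring
  · have : max n d = n := max_eq_left hle
    rw [this]
    have hlog : Real.log d ≤ Real.log n := Real.log_le_log hdpos (by exact_mod_cast hle)
    rw [abs_of_nonneg (by linarith)]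
    ring

end HeightNorm

/-! ### Towards Proposition 4.4.1 for `K = ℚ`: the lattice of a finitely generated subgroup
of `ℚ*` -/

section MinimalSystem

variable {ι : Type}

/-- A non-zero rational whose numerator and denominator are `< M` is a unit outside the primes
below `M`. [folklore] -/
theorem isPUnit_primesBelow {M : ℕ} {y : ℚ} (hy : y ≠ 0) (hnum : y.num.natAbs < M)
    (hden : y.den < M) : IsPUnit (Nat.primesBelow M) y := by
  refine ⟨hy, fun p hp hpP => ?_⟩
  have hpM : M ≤ p := by
    by_contra hlt
    push Not at hlt
    exact hpP (Nat.mem_primesBelow.mpr ⟨hlt, hp⟩)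
  haveI := Fact.mk hp
  have h1 : padicValNat p y.num.natAbs = 0 := by
    apply padicValNat.eq_zero_of_not_dvd
    intro hd
    have := Nat.le_of_dvd (Nat.pos_of_ne_zero (Int.natAbs_ne_zero.mpr (Rat.num_ne_zero.mpr hy))) hd
    omega
  have h2 : padicValNat p y.den = 0 := by
    apply padicValNat.eq_zero_of_not_dvd
    intro hd
    have := Nat.le_of_dvd y.den_pos hd
    omega
  show (padicValNat p y.num.natAbs : ℤ) - (padicValNat p y.den : ℤ) = 0
  rw [h1, h2]; simp

/-- Every vector of the lattice `span_ℤ {ord(ξᵢ)}` is the valuation vector of a `P`-unit (a product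
of powers of the `ξᵢ`), cf. (4.4.19). [cite: EvertseGyory2015, §4.4.2 (p. 81)] -/
theorem exists_isPUnit_of_mem_span {P : Finset ℕ} (hP : ∀ p ∈ P, p.Prime) {ξ : ι → ℚ}
    (hξ : ∀ i, IsPUnit P (ξ i)) {z : P → ℝ}
    (hz : z ∈ Submodule.span ℤ (Set.range (fun i => padicOrdVec P (ξ i)))) :
    ∃ y, IsPUnit P y ∧ padicOrdVec P y = z := by
  induction hz using Submodule.span_induction with
  | mem x hx =>
    obtain ⟨i, rfl⟩ := hx
    exact ⟨ξ i, hξ i, rfl⟩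
  | zero => exact ⟨1, isPUnit_one, padicOrdVec_one⟩
  | add x y _ _ hx hy =>
    obtain ⟨u, hu, rfl⟩ := hx
    obtain ⟨v, hv, rfl⟩ := hy
    exact ⟨u * v, hu.mul hv, padicOrdVec_mul hP hu.1 hv.1⟩
  | smul k x _ hx =>
    obtain ⟨u, hu, rfl⟩ := hx
    exact ⟨u ^ k, hu.zpow k, padicOrdVec_zpow hP u k⟩

/-- The lower bound `‖x‖ ≥ θ = log 2` on non-zero lattice vectors, for `K = ℚ` (Proposition
3.2.9 with `d = 1`; the printed `θ = 2/(d (log 3d)³)` is only valid for `d ≥ 2`).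
[cite: EvertseGyory2015, §4.4.2 (p. 81)] -/
theorem log_two_le_heightSeminorm_padicOrdVec {P : Finset ℕ} (hP : ∀ p ∈ P, p.Prime) {y : ℚ}
    (hy : IsPUnit P y) (hz : padicOrdVec P y ≠ 0) :
    Real.log 2 ≤ heightSeminorm P (padicOrdVec P y) := by
  rw [← logHeight₁_eq_heightSeminorm_padicOrdVec hP hy]
  apply log_two_le_logHeight₁ hy.1
  · rintro rfl; exact hz padicOrdVec_one
  · rintro rfl; exact hz (by rw [padicOrdVec_neg, padicOrdVec_one])

/-- A `P`-unit with zero valuation vector is `±1` (the kernel of `Γ → Γ/Γ_tors ↪ ℝ^P`).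
[folklore] -/
theorem eq_sign_of_padicOrdVec_eq_zero {P : Finset ℕ} (hP : ∀ p ∈ P, p.Prime) {y : ℚ}
    (hy : IsPUnit P y) (hz : padicOrdVec P y = 0) : y = 1 ∨ y = -1 := by
  by_contra hne
  push Not at hne
  have h1 := log_two_le_logHeight₁ hy.1 hne.1 hne.2
  rw [logHeight₁_eq_heightSeminorm_padicOrdVec hP hy, hz, map_zero] at h1
  linarith [Real.log_pos one_lt_two]

/-- Existence of a minimal system (abstract argmin): if the admissible systems with all entries
of `N`-size `≤ R` form a finite set containing `a₀`, and any admissible system with an entry of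
size `> R` has product `≥` that of `a₀`, then some admissible system minimises `∏ N(aᵢ)`.
[folklore] -/
theorem exists_min_system [Fintype ι] {E : Type*} (N : E → ℝ) (good : (ι → E) → Prop)
    (a₀ : ι → E) (h₀ : good a₀) (R : ℝ) (hR₀ : ∀ i, N (a₀ i) ≤ R)
    (hR : ∀ a', good a' → (∃ i, R < N (a' i)) → ∏ i, N (a₀ i) ≤ ∏ i, N (a' i))
    (S : Set E) (hS : S.Finite) (hmemS : ∀ a', good a' → ∀ i, N (a' i) ≤ R → a' i ∈ S) :
    ∃ aS, good aS ∧ ∀ a', good a' → ∏ i, N (aS i) ≤ ∏ i, N (a' i) := by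
  classical
  set T : Set (ι → E) := {a' | good a' ∧ ∀ i, a' i ∈ S} with hT
  have hTfin : T.Finite := by
    apply (Set.Finite.pi (t := fun (_ : ι) => S) fun _ => hS).subset
    intro a' ha'
    simp only [Set.mem_pi, Set.mem_univ, true_implies]
    exact ha'.2
  have ha₀T : a₀ ∈ hTfin.toFinset := by
    rw [Set.Finite.mem_toFinset]
    exact ⟨h₀, fun i => hmemS a₀ h₀ i (hR₀ i)⟩
  obtain ⟨aS, haS, hmin⟩ :=
    Finset.exists_min_image hTfin.toFinset (fun a' => ∏ i, N (a' i)) ⟨a₀, ha₀T⟩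
  rw [Set.Finite.mem_toFinset] at haS
  refine ⟨aS, haS.1, fun a' ha' => ?_⟩
  by_cases hall : ∀ i, N (a' i) ≤ R
  · apply hmin
    rw [Set.Finite.mem_toFinset]
    exact ⟨ha', fun i => hmemS a' ha' i (hall i)⟩
  · push Not at hall
    exact (hmin a₀ ha₀T).trans (hR a' ha' hall)

end MinimalSystem

/-! ### The constants of the proof of Theorem 4.2.1 for `d = 1` (Cases A and B, p. 81) -/

section Assembly

/-- `t / log t ≥ e` for `t > 1` (so `N(v)/log N(v) ≥ e` at every place). [folklore] -/
theorem exp_one_le_div_log {t : ℝ} (ht : 1 < t) : Real.exp 1 ≤ t / Real.log t := by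
  have hlogt : 0 < Real.log t := Real.log_pos ht
  have he : 0 < Real.exp 1 := Real.exp_pos 1
  rw [le_div_iff₀ hlogt]
  have h1 : Real.log t = Real.log (t / Real.exp 1) + 1 := by
    rw [Real.log_div (by linarith) he.ne', Real.log_exp]; ring
  have h2 : Real.log (t / Real.exp 1) ≤ t / Real.exp 1 - 1 :=
    Real.log_le_sub_one_of_pos (by positivity)
  calc Real.exp 1 * Real.log t = Real.exp 1 * (Real.log (t / Real.exp 1) + 1) := by rw [← h1]
    _ ≤ Real.exp 1 * (t / Real.exp 1) := by
        apply mul_le_mul_of_nonneg_left _ he.le; linarith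
    _ = t := by field_simp

/-- `log log 2 ≥ −1`, i.e. `log 2 ≥ 1/e`. [folklore] -/
theorem neg_one_le_log_log_two : -1 ≤ Real.log (Real.log 2) := by
  rw [← Real.log_exp (-1)]
  apply Real.log_le_log (Real.exp_pos _)
  have h1 : Real.exp (-1) < 0.3678794412 := Real.exp_neg_one_lt_d9
  have h2 : (0.6931471803 : ℝ) < Real.log 2 := Real.log_two_gt_d9
  linarith

/-- The elementary inequality behind Case A of the proof of Theorem 4.2.1 for `d = 1`:
`log*(c₁₇' X) ≤ 2 (m+1) log*(m) log*(X)` for `c₁₇' = m^{2m} / log 2` and `X ≥ 0` (this is where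
`C₆(m+1, 1) log*(B N/H)` is absorbed into `c₈ log*(N h(ξ)/H)`). [folklore] -/
theorem logStar_c17_mul_le (m : ℕ) {X : ℝ} (hX : 0 ≤ X) :
    logStar ((m : ℝ) ^ (2 * m) / Real.log 2 * X) ≤
      2 * ((m : ℝ) + 1) * max 1 (Real.log m) * logStar X := by
  have hlog2 : 0 < Real.log 2 := Real.log_pos one_lt_two
  have hM : 1 ≤ max 1 (Real.log m) := le_max_left _ _
  have hlogm : Real.log m ≤ max 1 (Real.log m) := le_max_right _ _
  have hlogm0 : 0 ≤ Real.log m := Real.log_natCast_nonneg m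
  have hm0 : (0 : ℝ) ≤ m := Nat.cast_nonneg m
  have hLX : 1 ≤ logStar X := one_le_logStar X
  have hll := neg_one_le_log_log_two
  -- the right-hand side is at least `2 (m+1) M ≥ 4`
  have hR1 : 1 ≤ 2 * ((m : ℝ) + 1) * max 1 (Real.log m) * logStar X := by
    have : (1 : ℝ) ≤ 2 * ((m : ℝ) + 1) := by linarith
    calc (1 : ℝ) = 1 * 1 * 1 := by ring
      _ ≤ 2 * ((m : ℝ) + 1) * max 1 (Real.log m) * logStar X :=
          mul_le_mul (mul_le_mul this hM zero_le_one (by linarith)) hLX zero_le_one (by positivity)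
  rcases hX.eq_or_lt with h0 | hXpos
  · subst h0
    have : logStar 0 = 1 := by simp [logStar]
    rw [mul_zero, this]
    rw [this] at hR1
    linarith
  have hc : 0 < (m : ℝ) ^ (2 * m) / Real.log 2 := by
    rcases Nat.eq_zero_or_pos m with rfl | hm
    · simp; exact hlog2
    · have : (0 : ℝ) < m := by exact_mod_cast hm
      positivity
  rw [logStar_def ((m : ℝ) ^ (2 * m) / Real.log 2 * X), Real.log_mul hc.ne' hXpos.ne',
    Real.log_div (by
      rcases Nat.eq_zero_or_pos m with rfl | hm
      · simp
      · have : (0 : ℝ) < m := by exact_mod_cast hm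
        positivity) hlog2.ne', Real.log_pow]
  push_cast
  apply max_le hR1
  -- main estimate
  have hT1 : 1 ≤ logStar X := hLX
  have hTL : Real.log X ≤ logStar X := le_max_right _ _
  have h1 : 2 * (m : ℝ) * Real.log m ≤ 2 * (m : ℝ) * max 1 (Real.log m) * logStar X := by
    calc 2 * (m : ℝ) * Real.log m ≤ 2 * (m : ℝ) * max 1 (Real.log m) :=
          mul_le_mul_of_nonneg_left hlogm (by positivity)
      _ = 2 * (m : ℝ) * max 1 (Real.log m) * 1 := by ring
      _ ≤ 2 * (m : ℝ) * max 1 (Real.log m) * logStar X :=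
          mul_le_mul_of_nonneg_left hT1 (by positivity)
  have h2 : -Real.log (Real.log 2) ≤ max 1 (Real.log m) * logStar X := by
    calc -Real.log (Real.log 2) ≤ 1 := by linarith
      _ = 1 * 1 := by ring
      _ ≤ max 1 (Real.log m) * logStar X := mul_le_mul hM hT1 zero_le_one (by positivity)
  have h3 : Real.log X ≤ max 1 (Real.log m) * logStar X := by
    calc Real.log X ≤ logStar X := hTL
      _ = 1 * logStar X := by ring
      _ ≤ max 1 (Real.log m) * logStar X := mul_le_mul_of_nonneg_right hM (by linarith)
  linarith

/-- `c₈(m) = 2 (m+1) log*(m) · C₆(m+1, 1)` (the definition of `c₈`, p. 68, versus `C₆`, p. 62).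
[cite: EvertseGyory2015, Thm 4.2.1 (p. 68)] -/
theorem egC8_eq_mul_egC6 (m : ℕ) :
    egC8 m = 2 * ((m : ℝ) + 1) * max 1 (Real.log m) * egC6 (m + 1) := by
  rw [egC8_def, egC6_def]
  have h3 : 3 * (m + 1) + 2 = 3 * m + 5 := by ring
  rw [h3]
  by_cases hm : m = 1
  · subst hm; simp; ring
  · have : m + 1 ≠ 2 := by omega
    simp [hm, this]

/-- `C₆ ≥ 0`. [folklore] -/
theorem egC6_nonneg (n : ℕ) : 0 ≤ egC6 n := by
  rw [egC6_def]
  have : (0 : ℝ) ≤ (if n = 2 then (12 : ℝ) else 1) := by split_ifs <;> norm_num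
  positivity

/-- `c₈ ≥ 0`. [folklore] -/
theorem egC8_nonneg (m : ℕ) : 0 ≤ egC8 m := by
  rw [egC8_eq_mul_egC6]
  have := egC6_nonneg (m + 1)
  have : (0 : ℝ) ≤ max 1 (Real.log m) := le_trans zero_le_one (le_max_left _ _)
  positivity

/-- `4 (16e)^{3m+5} ≤ c₈(m)` for `m ≥ 1`. [folklore] -/
theorem four_mul_pow_le_egC8 (m : ℕ) (hm : 1 ≤ m) :
    4 * (16 * Real.exp 1) ^ (3 * m + 5) ≤ egC8 m := by
  rw [egC8_def]
  have hlam : (1 : ℝ) ≤ (if m = 1 then (12 : ℝ) else 1) := by split_ifs <;> norm_num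
  have hm1 : (2 : ℝ) ≤ (m : ℝ) + 1 := by
    have : (1 : ℝ) ≤ m := by exact_mod_cast hm
    linarith
  have hM : (1 : ℝ) ≤ max 1 (Real.log m) := le_max_left _ _
  have hE : (0 : ℝ) ≤ (16 * Real.exp 1) ^ (3 * m + 5) := by positivity
  calc 4 * (16 * Real.exp 1) ^ (3 * m + 5)
      = (2 * 1 * 2 * 1) * (16 * Real.exp 1) ^ (3 * m + 5) := by ring
    _ ≤ (2 * (if m = 1 then (12 : ℝ) else 1) * ((m : ℝ) + 1) * max 1 (Real.log m)) *
          (16 * Real.exp 1) ^ (3 * m + 5) := by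
        apply mul_le_mul_of_nonneg_right _ hE
        have h1 : (2 * 1 : ℝ) ≤ 2 * (if m = 1 then (12 : ℝ) else 1) := by linarith
        calc (2 * 1 * 2 * 1 : ℝ) = (2 * 1) * 2 * 1 := by ring
          _ ≤ (2 * (if m = 1 then (12 : ℝ) else 1)) * ((m : ℝ) + 1) * max 1 (Real.log m) := by
              apply mul_le_mul _ hM zero_le_one (by positivity)
              exact mul_le_mul h1 hm1 zero_le_two (by positivity)
    _ = _ := by ring

/-- Case A of the proof of Theorem 4.2.1 (`d = 1`), constants: with `Θ' ≤ Θ` and `k = N/log N`,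
`C₆(m+1) k Θ' H log*(c₁₇' h N / H) ≤ c₈(m) k Θ H log*(N h / H)`.
[cite: EvertseGyory2015, §4.4.2 (p. 81)] -/
theorem eg421_caseA_bound (m : ℕ) {Θ Θ' H hx Nv k : ℝ} (hΘ' : Θ' ≤ Θ) (hΘ'0 : 0 ≤ Θ')
    (hH : 1 ≤ H) (hhx : 0 ≤ hx) (hNv : 0 ≤ Nv) (hk : 0 ≤ k) :
    egC6 (m + 1) * k * Θ' * H * logStar ((m : ℝ) ^ (2 * m) / Real.log 2 * hx * Nv / H) ≤
      egC8 m * k * Θ * H * logStar (Nv * hx / H) := by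
  have hX : 0 ≤ Nv * hx / H := by
    apply div_nonneg (mul_nonneg hNv hhx); linarith
  have h1 := logStar_c17_mul_le m hX
  have heq : (m : ℝ) ^ (2 * m) / Real.log 2 * hx * Nv / H =
      (m : ℝ) ^ (2 * m) / Real.log 2 * (Nv * hx / H) := by ring
  rw [heq, egC8_eq_mul_egC6]
  have hC6 := egC6_nonneg (m + 1)
  have hL0 : 0 ≤ logStar ((m : ℝ) ^ (2 * m) / Real.log 2 * (Nv * hx / H)) :=
    le_trans zero_le_one (one_le_logStar _)
  have hΘ0 : 0 ≤ Θ := le_trans hΘ'0 hΘ'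
  calc egC6 (m + 1) * k * Θ' * H * logStar ((m : ℝ) ^ (2 * m) / Real.log 2 * (Nv * hx / H))
      ≤ egC6 (m + 1) * k * Θ * H * logStar ((m : ℝ) ^ (2 * m) / Real.log 2 * (Nv * hx / H)) := by
        apply mul_le_mul_of_nonneg_right _ hL0
        apply mul_le_mul_of_nonneg_right _ (by linarith)
        exact mul_le_mul_of_nonneg_left hΘ' (by positivity)
    _ ≤ egC6 (m + 1) * k * Θ * H *
          (2 * ((m : ℝ) + 1) * max 1 (Real.log m) * logStar (Nv * hx / H)) := by
        apply mul_le_mul_of_nonneg_left h1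
        have : 0 ≤ H := by linarith
        positivity
    _ = 2 * ((m : ℝ) + 1) * max 1 (Real.log m) * egC6 (m + 1) * k * Θ * H *
          logStar (Nv * hx / H) := by ring

/-- Case B of the proof of Theorem 4.2.1 (`d = 1`), constants: if
`t < log 2 + H + 2e 9^{m+1} Θ H`, `Θ ≥ (log 2)^m` ((4.4.20) for `d = 1`), `H ≥ 1`, `k ≥ e`,
`L ≥ 1`, then `−c₈(m) k Θ H L < −t`. [cite: EvertseGyory2015, §4.4.2 (p. 81)] -/
theorem eg421_caseB_bound (m : ℕ) (hm : 1 ≤ m) {Θ H k L t : ℝ} (hΘ : Real.log 2 ^ m ≤ Θ)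
    (hH : 1 ≤ H)
    (hk : Real.exp 1 ≤ k) (hL : 1 ≤ L)
    (ht : t < Real.log 2 + H + 2 * Real.exp 1 * 9 ^ (m + 1) * Θ * H) :
    -(egC8 m * k * Θ * H * L) < -t := by
  have hlog2 : 0 < Real.log 2 := Real.log_pos one_lt_two
  have hl2' : Real.log 2 < 1 := by
    have := Real.log_two_lt_d9; linarith
  have he1 : Real.exp 1 < 3 := by
    have := Real.exp_one_lt_d9; linarith
  have he0 : 0 < Real.exp 1 := Real.exp_pos 1
  have hΘpos : 0 < Θ := lt_of_lt_of_le (pow_pos hlog2 m) hΘ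
  have hH0 : 0 < H := by linarith
  -- H ≤ 2^m Θ H
  have h2Θ : 1 ≤ 2 ^ m * Θ := by
    have h22 : (1 : ℝ) ≤ 2 * Real.log 2 := by
      have := Real.log_two_gt_d9; linarith
    calc (1 : ℝ) ≤ (2 * Real.log 2) ^ m := one_le_pow₀ h22
      _ = 2 ^ m * Real.log 2 ^ m := by rw [mul_pow]
      _ ≤ 2 ^ m * Θ := mul_le_mul_of_nonneg_left hΘ (by positivity)
  have hstep1 : Real.log 2 + H ≤ 2 * 2 ^ m * Θ * H := by
    calc Real.log 2 + H ≤ 2 * H := by linarith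
      _ = 2 * H * 1 := by ring
      _ ≤ 2 * H * (2 ^ m * Θ) := mul_le_mul_of_nonneg_left h2Θ (by positivity)
      _ = 2 * 2 ^ m * Θ * H := by ring
  -- 2·2^m + 2e 9^{m+1} < 4 e (16e)^{3m+5} ≤ e c₈
  have h29 : (2 : ℝ) * 2 ^ m ≤ 9 ^ (m + 1) := by
    rw [pow_succ]
    have : (2 : ℝ) ^ m ≤ 9 ^ m := pow_le_pow_left₀ (by norm_num) (by norm_num) m
    nlinarith [pow_nonneg (show (0:ℝ) ≤ 9 by norm_num) m]
  have h916 : (9 : ℝ) ^ (m + 1) ≤ (16 * Real.exp 1) ^ (3 * m + 5) := by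
    have h16 : (9 : ℝ) ≤ 16 * Real.exp 1 := by
      have := Real.add_one_le_exp (1 : ℝ); nlinarith
    have h16' : (1 : ℝ) ≤ 16 * Real.exp 1 := by linarith
    calc (9 : ℝ) ^ (m + 1) ≤ (16 * Real.exp 1) ^ (m + 1) :=
          pow_le_pow_left₀ (by norm_num) h16 _
      _ ≤ (16 * Real.exp 1) ^ (3 * m + 5) := pow_le_pow_right₀ h16' (by omega)
  have hc8 := four_mul_pow_le_egC8 m hm
  have hconst : 2 * 2 ^ m + 2 * Real.exp 1 * 9 ^ (m + 1) < Real.exp 1 * egC8 m := by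
    have h9pos : (0 : ℝ) < 9 ^ (m + 1) := by positivity
    calc 2 * 2 ^ m + 2 * Real.exp 1 * 9 ^ (m + 1)
        ≤ 9 ^ (m + 1) + 2 * Real.exp 1 * 9 ^ (m + 1) := by linarith
      _ = (1 + 2 * Real.exp 1) * 9 ^ (m + 1) := by ring
      _ < 7 * 9 ^ (m + 1) := by
          apply mul_lt_mul_of_pos_right _ h9pos; linarith
      _ ≤ 7 * (16 * Real.exp 1) ^ (3 * m + 5) := by linarith
      _ ≤ (4 * Real.exp 1) * (16 * Real.exp 1) ^ (3 * m + 5) := by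
          apply mul_le_mul_of_nonneg_right _ (by positivity)
          have := Real.add_one_le_exp (1 : ℝ); linarith
      _ = Real.exp 1 * (4 * (16 * Real.exp 1) ^ (3 * m + 5)) := by ring
      _ ≤ Real.exp 1 * egC8 m := mul_le_mul_of_nonneg_left hc8 he0.le
  have hc8nn : 0 ≤ egC8 m := egC8_nonneg m
  have hk0 : 0 < k := lt_of_lt_of_le he0 hk
  -- assemble
  have hmain : t < egC8 m * k * Θ * H * L := by
    calc t < Real.log 2 + H + 2 * Real.exp 1 * 9 ^ (m + 1) * Θ * H := ht
      _ ≤ 2 * 2 ^ m * Θ * H + 2 * Real.exp 1 * 9 ^ (m + 1) * Θ * H := by linarith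
      _ = (2 * 2 ^ m + 2 * Real.exp 1 * 9 ^ (m + 1)) * (Θ * H) := by ring
      _ ≤ (Real.exp 1 * egC8 m) * (Θ * H) :=
          mul_le_mul_of_nonneg_right hconst.le (by positivity)
      _ = egC8 m * Real.exp 1 * Θ * H * 1 := by ring
      _ ≤ egC8 m * k * Θ * H * L := by
          apply mul_le_mul _ hL zero_le_one (by positivity)
          apply mul_le_mul_of_nonneg_right _ hH0.le
          apply mul_le_mul_of_nonneg_right _ hΘpos.le
          exact mul_le_mul_of_nonneg_left hk hc8nn
  linarith

end Assembly

end Literature.NumberTheory.DiophantineGeometry.Dioph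

end
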